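import Literature.MathematicalPhysics.QuantumFieldTheory.Balaban1983to89.B8Ineq159FlatCubeMemberPrintedRec
import Literature.MathematicalPhysics.QuantumFieldTheory.Balaban1983to89.B8Ineq159FlatDentedCubeMemberTransplant
import Literature.MathematicalPhysics.QuantumFieldTheory.Balaban1983to89.Node00.CarriersB8CubeDentedRecTranslate

/-!
# `Balaban1983to89.B8Ineq159FlatDentedCubeMemberPrintedRec` — [Balaban1985RegularSpaces] (1.59) p. 86 AT `U₀ = 1` ON THE DENTED CUBE TOWER `{Ω′_j}` OF
# [Balaban1985Variational] (148)–(150), FOR THE RECORD's CENTRED TOWER ([Balaban1987RG1] (0.3)): the named fact `Ineq159FlatDentedCubeMemberPrintedZ d L` — the RECORD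
# TWIN of `B8Ineq159FlatDentedCubeMemberPrinted.Ineq159FlatDentedCubeMemberPrinted` — and its PROOF for every odd `L = ℓ + 1 ≥ 5` by the (T2) TRANSLATION
# `x ↦ x + ctrShift L k·𝟙` (`Node00.CubeB8DZ.translate`) from the engine's theorem `B8Ineq159FlatDentedCubeMemberTransplant.ineq159FlatDentedCubeMemberPrinted_holds`

statement-level skeleton of published theorems with citation tags; proofs where landed; nothing here is a claim about the Yang–Mills mass gap

CITATION HEADER (lean-in-tree rule).  Cell `pub-ymgap` (HUMAN RULING D-0062), «N05-REC» road (director-ym №254∕№255; LEAD PEN dag-n05-e g38; desk `R6-PLAN.md` §2 row (e)′-2: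
the engine crown `B8Prop6DentedCubeMemberScalarGammaOfNamedFacts.gaugedBoundB8D_dentedMember_scalar_γ_of_namedFacts` consumes the named fact
`Ineq159FlatDentedCubeMemberPrinted d L` at the TOP truncation of the dented member; its record twin consumes THIS file's `Ineq159FlatDentedCubeMemberPrintedZ d L`).
[6] = [Balaban1985RegularSpaces] (1.59) p. 86, (1.62) p. 87, (1.31) p. 82, (1.38) p. 82, (1.131)–(1.132) p. 99, p. 98, (1.3)–(1.4) p. 77; [15] = [Balaban1985Variational] p. 300,
(144) p. 300, (148)–(150) p. 301, (152) p. 301; [4] = [Balaban1985BackgroundPropagators] Thm 3.3 p. 399; [B6] = [Balaban1984PropagatorsII] Prop. 2.6 p. 247, (2.3) p. 224;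
[I] = [Balaban1987RG1] (0.3) p. 252 (CENTRED blocks «Bᵏ(y) = {x : |x_μ − Lᵏy_μ| ≤ (Lᵏ−1)∕2}»).  `--kind definition --supports stmt-QuantumFields-20541` (K0⁷; count-neutral).
REUSED BY NAME: the engine fact + proof (`B8Ineq159FlatDentedCubeMemberPrinted`, `B8Ineq159FlatDentedCubeMemberTransplant`); the translated datum and its dictionary
`Node00.CubeB8DZ.{translate, lamBPZ, image_add_ctrShift_sq, image_add_ctrShift_lamS, mem_lamBPZ_iff_add_ctrShift, anchored_translate, bondTouches_translate_iff}`
(`Node00/CarriersB8CubeDentedRecTranslate`, this pen); the pure twin's `B8Ineq159FlatCubeMemberPrintedRec.{sideTouches_image_add_iff, isLandau138_image_of_isLandau138Z,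
linQIterZ_eq_linQIter_add_ctrShift}` (p717853); `B8DentedCubeMemberTorusSizeLines.exists_near_of_ne_zero`, `B8CubeMemberTorusSizeLines.exists_bound_of_near`,
`B8FlatOperatorsTranslateLocal.{covDerivFwd∕Jcur∕covLap}_one_translate`, `B9Eq316TowerFlatIsOneStep.linCovIter_one_left` (ENGINE side only; DO-NOT-REKEY respected: no
`linCovIterZ` in this file).

WHY TRANSLATION (as for the pure member, `B8Ineq159FlatCubeMemberPrintedRec`).  For the SAME datum `(a, M, ρ, k; {Ω_j})` the record's dented tower `CubeB8DZ.sq ∕ lamS`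
is the engine's dented tower of the TRANSLATED ambient family `Ω_j + c_k·𝟙`, read through `x ↦ x + c_k·𝟙` (fine sites) and `z ↦ z + c_{k−j}·𝟙` (level-`j` labels); the
centred block law becomes the corner one (`flm L k (x + c_k) = flmZ L k x`), «□̃ ⊂ Ω_{k−1}» is preserved (`(· + c_k) '' tcubeZ = tcube`), and the dent premise moves its
anchor from the record's `Lᵏ(a − ρ) − c_k` to the engine's `Lᵏ(a − ρ)`.  So `c : CubeB8DZ` yields an ENGINE datum `c.translate : CubeB8D d L K (Ω + c_k)` (`Node00/CarriersB8CubeDentedRecTranslate`) on which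
the engine's PROVED fact is evaluated at `ψ := φ(· − c_k·𝟙)`; every letter of (1.59) at the flat background is translation-covariant, so the record fact follows on `ℤᵈ`
(the engine's dented torus-transplant modules are not re-keyed).  The averaging datum is print's STRAIGHT average `linQIterZ` ([B6] (1.18), centred) as in the pure twin;
the record's `linCovIterZ L 1` differs from it by the carried letter `dΘ_j` (`B7Prop4FlatCarriedLetterRec.linCovIterZ_one_eq`, director-ym №269 route (a)), absorbed
downstream into the datum (`B₁′ = B₁ − dΘ_j`).

WHAT IS PROVED (sorry-free).  §1 def ★★ `Ineq159FlatDentedCubeMemberPrintedZ d L` (the twin statement).  §2 ★★ `ineq159FlatDentedCubeMemberPrintedZ_of_printed`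
(engine fact ⟹ record fact, odd `L`), ★★★ `ineq159FlatDentedCubeMemberPrintedZ_holds (d ℓ) (4 ≤ ℓ) (Odd (ℓ+1))` — UNCONDITIONAL.
HONEST SCOPE.  A flat-background bookkeeping transfer of an already-proved theorem; no new estimate; nothing of [4]∕[6]∕[15]∕[B6]∕[I] newly asserted; `HThm4Rec` UNDISCHARGED;
N05 ∕ N07 NOT discharged; counts unmoved (typed 28∕28 · discharged 8∕28); one finite 𝕋⁴ programme at fixed ε — nothing continuum ∕ ℝ⁴ ∕ OS ∕ mass gap ∕ Clay.  No `instance`,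
no `notation`, no `sorry`.
-/

set_option autoImplicit false
noncomputable section
open scoped BigOperators

namespace Literature.MathematicalPhysics.QuantumFieldTheory.Balaban1983to89.B8Ineq159FlatDentedCubeMemberPrintedRec

open B7Prop1Explicit (e)
open B7Prop1Local (InBox)
open B7Prop4Flat (linQIter)
open B7Prop4GeneralLevels (linCovIter)
open B9Eq316TowerFlatIsOneStep (linCovIter_one_left)
open B7SectEFLinearisationRec (linQIterZ)
open BlockAveragingZd (ctrShift)
open Literature.MathematicalPhysics.QuantumLattice (blockMap)
open B8Ineq132 (covDerivFwd BondTouches Under)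
open B8Eq140Level (SideTouches)
open B8Eq146AExpansion (iEta norm_iEta_le)
open B8Eq155JBound (Jcur)
open B8Eq138LandauZd (IsLandau138 covLap)
open B8Eq138LandauZdRec (IsLandau138Z)
open B8Ineq159FlatCubeMemberPrintedRec (sideTouches_image_add_iff isLandau138_image_of_isLandau138Z linQIterZ_eq_linQIter_add_ctrShift)
open B8Ineq159FlatDentedCubeMemberPrinted (Ineq159FlatDentedCubeMemberPrinted)
open B8Ineq159FlatDentedCubeMemberTransplant (ineq159FlatDentedCubeMemberPrinted_holds)
open B8CubeMemberTorusSizeLines (exists_bound_of_near)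
open B8FlatOperatorsTranslateLocal (covDerivFwd_one_translate Jcur_one_translate covLap_one_translate)
open Node00 (CubeB8D CubeB8DZ bondTouches_translate_iff)

variable {d : ℕ}

/-! ## §1 The named fact for the dented RECORD tower -/

/-- (RECORD TWIN of `B8Ineq159FlatDentedCubeMemberPrinted.Ineq159FlatDentedCubeMemberPrinted`.) **[Balaban1985RegularSpaces] (1.59) AT THE FLAT BACKGROUND `U₀ = 1` ON
THE DENTED CUBE TOWER `{Ω′_j}` OF [Balaban1985Variational] (148)–(150), TOP TRUNCATION, CENTRED TOWER, AVERAGING DATUM OVER PRINT'S CLASS** (= [4] Thm 3.3 at `U = 1`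
with Dirichlet exterior on `□₀`, for `Ω′₀ = □₀ ⊃ … ⊃ Ω′_{k−1} = □_{k−1} ⊃ Ω′_k = □_k ∩ Ω_k`): `B₀ > 0` and thresholds `ρ₀, M₀, N₀, R₀` such that for every `η > 0`, every
ambient family `{Ω_j}_{j ≤ K}`, every dented RECORD cube datum `c : CubeB8DZ d L K Ω` on print's p. 98 big-block sub-lattice (`M_h = Lˢ`; the seven side conditions
verbatim) whose top member `Ω_k` is a union of cubes of side `L^{s+1}·Lᵏ` of the grid anchored at `□_k`'s fine lower corner `Lᵏ(c.a − c.ρ) − c_k·𝟙` (centred blow-up;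
(1.4)₂ on the grid carrying `□_k`, [15] p. 300), and every ℂ-valued `φ` in the flat Landau gauge (1.38) for the RECORD blocking on the dented tower (`IsLandau138Z`,
`Ω′₀ = c.sq 0`, cells `c.lamS`): if `N ≥ 0` bounds (i) `(Lʲη)³|J(φ)|` on the bonds of `Ω′_j`, (ii) the STRAIGHT centred averages `‖linQIterZ L (iηφ) j b‖` on every bond
`b` of print's class `c.lamBPZ j`, (iii) `η|φ|` on the outer layer, then on every bond side-touching `Ω′_j`: `(Lʲη)|φ| ≤ B₀N`, `(Lʲη)²|D^η_{1,ν}φ_τ| ≤ B₀N`,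
`(Lʲη)³|Δ^η_1φ_τ| ≤ B₀N` — (1.59) at `U₀ = 1`, pointwise form (1.62) ∕ (152).  The engine statement under `CubeB8D ↦ CubeB8DZ`, `IsLandau138 ↦ IsLandau138Z`, `lamBP ↦
lamBPZ`, `linCovIter L 1 ↦ linQIterZ L`, record anchor.  Named here; PROVED below for odd `L ≥ 5` (`ineq159FlatDentedCubeMemberPrintedZ_holds`).
[cite: Balaban1985RegularSpaces, (1.59) p.86, (1.62) p.87, (1.31) p.82, (1.38) p.82, (1.131)–(1.132) p.99, p.98, (1.4) p.77; Balaban1985Variational, (148)–(150) p.301, (152) p.301, p.300; Balaban1985BackgroundPropagators, Thm 3.3 p.399, (3.47) p.398; Balaban1984PropagatorsII, Prop. 2.6 (2.136) p.247, (2.3) p.224; Balaban1987RG1, (0.3) p.252] -/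
def Ineq159FlatDentedCubeMemberPrintedZ (d L : ℕ) : Prop :=
  ∃ B₀ ρ₀ M₀ : ℝ, ∃ N₀ R₀ : ℕ, 0 < B₀ ∧
    ∀ (η : ℝ), 0 < η → ∀ (K : ℕ) (Ω : ℕ → Set (B7Prop1Explicit.Site d)) (c : CubeB8DZ d L K Ω) (s R : ℕ),
      M₀ ≤ (L : ℝ) ^ (s + 1) → L ^ (s + 1) ∣ c.ρ → L ^ (s + 1) ∣ c.M → R * L ^ (s + 1) ≤ c.ρ → R₀ ≤ R →
      N₀ + 1 ≤ R * L ^ (s + 1) → ρ₀ ≤ (c.ρ : ℝ) →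
      (∀ x y : B7Prop1Explicit.Site d,
          blockMap (L ^ (s + 1) * L ^ c.k) (x - fun i => (L : ℤ) ^ c.k * (c.a i - c.ρ) - (ctrShift L c.k : ℤ)) =
            blockMap (L ^ (s + 1) * L ^ c.k) (y - fun i => (L : ℤ) ^ c.k * (c.a i - c.ρ) - (ctrShift L c.k : ℤ)) → x ∈ Ω c.k → y ∈ Ω c.k) →
      ∀ φ : B7Prop1Explicit.Site d → Fin d → ℂ,
        IsLandau138Z L c.k η (c.sq 0) c.lamS (1 : B7Prop1Explicit.Site d → Fin d → ℂˣ) φ →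
        (∀ (y : B7Prop1Explicit.Site d) (τ : Fin d), (∀ j, j ≤ c.k → ¬ SideTouches (c.sq j) y τ) → φ y τ = 0) →
        ∀ N : ℝ, 0 ≤ N →
          (∀ j, j ≤ c.k → ∀ (y : B7Prop1Explicit.Site d) (τ : Fin d), BondTouches (c.sq j) y τ →
              ((L : ℝ) ^ j * η) ^ 3 * ‖Jcur η (1 : B7Prop1Explicit.Site d → Fin d → ℂˣ) φ τ y‖ ≤ N) →
          (∀ j, j ≤ c.k → ∀ b ∈ c.lamBPZ j, ‖linQIterZ L (iEta η φ) j b.1 b.2‖ ≤ N) →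
          (∀ (y : B7Prop1Explicit.Site d) (τ : Fin d), ¬ BondTouches (c.sq 0) y τ → η * ‖φ y τ‖ ≤ N) →
          ∀ j, j ≤ c.k → ∀ (y : B7Prop1Explicit.Site d) (τ : Fin d), SideTouches (c.sq j) y τ →
            ((L : ℝ) ^ j * η) * ‖φ y τ‖ ≤ B₀ * N ∧
            (∀ ν : Fin d, ((L : ℝ) ^ j * η) ^ 2 *
                ‖covDerivFwd η (1 : B7Prop1Explicit.Site d → Fin d → ℂˣ) ν (fun z => φ z τ) y‖ ≤ B₀ * N) ∧
            ((L : ℝ) ^ j * η) ^ 3 * ‖covLap η (1 : B7Prop1Explicit.Site d → Fin d → ℂˣ) (fun z => φ z τ) y‖ ≤ B₀ * N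

/-! ## §2 The record fact from the engine fact, by translation -/

/-- ★★ **THE RECORD FACT FROM THE ENGINE FACT, BY TRANSLATION** (odd `L = ℓ + 1`): apply the engine's (1.59) on the dented member to the translated datum `c.translate`
and the translated field `ψ := φ(· − c_k·𝟙)`; its hypotheses are the record's read through §2 and the pure twin's §2–§4 (tower, cells, class, touch predicates, (1.38), `J`,
the straight averages — `linCovIter L 1 (iηψ) j = linQIter L (iηψ) j` on the ENGINE side by `linCovIter_one_left`, `ψ` being bounded as a field supported near `□₀` — the
outer layer, the dent premise), and its conclusion at `⟨y + c_k·𝟙, τ⟩` is the record's at `⟨y, τ⟩`.  Same constants `B₀, ρ₀, M₀, N₀, R₀`.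
[cite: Balaban1985RegularSpaces, (1.59) p.86, (1.62) p.87, p.98; Balaban1985Variational, (148)–(152) p.301; Balaban1987RG1, (0.3) p.252] -/
theorem ineq159FlatDentedCubeMemberPrintedZ_of_printed (d ℓ : ℕ) (hodd : Odd (ℓ + 1)) (h : Ineq159FlatDentedCubeMemberPrinted (d + 1) (ℓ + 1)) :
    Ineq159FlatDentedCubeMemberPrintedZ (d + 1) (ℓ + 1) := by
  classical
  obtain ⟨B₀, ρ₀, M₀, N₀, R₀, hB₀, H⟩ := h
  refine ⟨B₀, ρ₀, M₀, N₀, R₀, hB₀, ?_⟩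
  intro η hη K Ω c s R hM0 hρdiv hMdiv hRρ hR0 hN01 hρ0 hΩ φ hLan hsupp N hN0 hJ hQ hout j hjk y τ hside
  have hL1 : 1 ≤ ℓ + 1 := Nat.succ_pos ℓ
  -- the translation vector and the translated field
  set tK : B7Prop1Explicit.Site (d + 1) := fun _ => (ctrShift (ℓ + 1) c.k : ℤ) with htK
  set ψ : B7Prop1Explicit.Site (d + 1) → Fin (d + 1) → ℂ := fun w => φ (w - tK) with hψ
  have hfam : ∀ j', (fun x : B7Prop1Explicit.Site (d + 1) => x + tK) '' c.sq j' = (c.translate hodd).sq j' :=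
    fun j' => c.image_add_ctrShift_sq hodd j'
  -- support of `ψ`: off every touching bond of the translated tower
  have hsuppψ : ∀ (y' : B7Prop1Explicit.Site (d + 1)) (τ' : Fin (d + 1)),
      (∀ j', j' ≤ (c.translate hodd).k → ¬ SideTouches ((c.translate hodd).sq j') y' τ') → ψ y' τ' = 0 := by
    intro y' τ' hno
    refine hsupp (y' - tK) τ' fun j' hj' hs => hno j' hj' ?_
    rw [← hfam j', ← sub_add_cancel y' tK]
    exact (sideTouches_image_add_iff _ _ _ _).2 hs
  -- (1.38) for `ψ`, engine blocking on the translated tower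
  have hLanψ : IsLandau138 (ℓ + 1) (c.translate hodd).k η ((c.translate hodd).sq 0) (c.translate hodd).lamS
      (1 : B7Prop1Explicit.Site (d + 1) → Fin (d + 1) → ℂˣ) ψ := by
    have h1 := isLandau138_image_of_isLandau138Z hodd (le_refl c.k) hLan
    have hΛ : (fun j' => (fun z : B7Prop1Explicit.Site (d + 1) => z + fun _ => (ctrShift (ℓ + 1) (c.k - j') : ℤ)) '' c.lamS j') =
        (c.translate hodd).lamS := funext fun j' => c.image_add_ctrShift_lamS hodd j'
    rw [hfam 0, hΛ] at h1
    exact h1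
  -- (i) the `J` bound for `ψ`
  have hJψ : ∀ j', j' ≤ (c.translate hodd).k → ∀ (y' : B7Prop1Explicit.Site (d + 1)) (τ' : Fin (d + 1)),
      BondTouches ((c.translate hodd).sq j') y' τ' →
      (((ℓ + 1 : ℕ) : ℝ) ^ j' * η) ^ 3 * ‖Jcur η (1 : B7Prop1Explicit.Site (d + 1) → Fin (d + 1) → ℂˣ) ψ τ' y'‖ ≤ N := by
    intro j' hj' y' τ' hb
    rw [hψ, Jcur_one_translate]
    refine hJ j' hj' (y' - tK) τ' ?_
    rw [← bondTouches_translate_iff _ tK, sub_add_cancel, hfam]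
    exact hb
  -- `ψ` is bounded (supported near `□₀`), so the engine composite at `U₀ = 1` is the straight average
  obtain ⟨Mψ, hMψ0, hMψ⟩ := exists_bound_of_near (c.translate hodd).a fun z τ' hz =>
    B8DentedCubeMemberTorusSizeLines.exists_near_of_ne_zero (c.translate hodd) hsuppψ hz
  have hb : ∀ w ν, ‖iEta η ψ w ν‖ ≤ η * Mψ := fun w ν => norm_iEta_le hη.le hMψ w ν
  -- (ii) the averaging datum for `ψ` over print's class of the translated tower
  have hQψ : ∀ j', j' ≤ (c.translate hodd).k → ∀ b ∈ (c.translate hodd).lamBP j',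
      ‖linCovIter (ℓ + 1) (1 : B7Prop1Explicit.Site (d + 1) → Fin (d + 1) → ℂˣ) (iEta η ψ) j' b.1 b.2‖ ≤ N := by
    intro j' hj' b hb'
    rw [linCovIter_one_left (ℓ + 1) hL1 _ (by positivity) hb j']
    have hiEta : iEta η ψ = fun w ν => iEta η φ (w - tK) ν := rfl
    have key := linQIterZ_eq_linQIter_add_ctrShift hodd (iEta η φ) c.k j' hj'
      (b.1 - fun _ => (ctrShift (ℓ + 1) (c.k - j') : ℤ)) b.2
    rw [sub_add_cancel] at key
    rw [hiEta, ← key]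
    refine hQ j' hj' ((b.1 - fun _ => (ctrShift (ℓ + 1) (c.k - j') : ℤ)), b.2) ?_
    rw [c.mem_lamBPZ_iff_add_ctrShift hodd, sub_add_cancel]
    exact hb'
  -- (iii) the outer layer for `ψ`
  have houtψ : ∀ (y' : B7Prop1Explicit.Site (d + 1)) (τ' : Fin (d + 1)), ¬ BondTouches ((c.translate hodd).sq 0) y' τ' → η * ‖ψ y' τ'‖ ≤ N := by
    intro y' τ' hnb
    refine hout (y' - tK) τ' fun hb' => hnb ?_
    rw [← hfam 0, ← sub_add_cancel y' tK]
    exact (bondTouches_translate_iff _ _ _ _).2 hb'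
  -- the dent premise for the translated ambient family
  have hΩ' := c.anchored_translate hΩ
  -- the engine fact at the translated bond
  have hside' : SideTouches ((c.translate hodd).sq j) (y + tK) τ := by
    rw [← hfam j]; exact (sideTouches_image_add_iff _ _ _ _).2 hside
  obtain ⟨h1, h2, h3⟩ := H η hη K _ (c.translate hodd) s R hM0 hρdiv hMdiv hRρ hR0 hN01 hρ0 hΩ' ψ hLanψ hsuppψ N hN0 hJψ hQψ houtψ
    j hjk (y + tK) τ hside'
  refine ⟨?_, fun ν => ?_, ?_⟩
  · simpa only [hψ, add_sub_cancel_right] using h1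
  · have h2ν := h2 ν
    simp only [hψ] at h2ν
    rwa [covDerivFwd_one_translate, add_sub_cancel_right] at h2ν
  · have hc : covLap η (1 : B7Prop1Explicit.Site (d + 1) → Fin (d + 1) → ℂˣ) (fun z => ψ z τ) (y + tK) =
        covLap η (1 : B7Prop1Explicit.Site (d + 1) → Fin (d + 1) → ℂˣ) (fun z => φ z τ) (y + tK - tK) :=
      covLap_one_translate η tK (fun w => φ w τ) (y + tK)
    rwa [hc, add_sub_cancel_right] at h3

/-- ★★★ **(1.59) AT `U₀ = 1` ON THE DENTED RECORD CUBE TOWER, UNCONDITIONAL for every odd `L = ℓ + 1 ≥ 5`**: the engine's theorem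
`B8Ineq159FlatDentedCubeMemberTransplant.ineq159FlatDentedCubeMemberPrinted_holds` ([4] Thm 3.3 at `U = 1` by transplant to lit-balaban's multi-level torus estimates on the
dented torus member) moved to the record tower by `ineq159FlatDentedCubeMemberPrintedZ_of_printed`.
[cite: Balaban1985RegularSpaces, (1.59) p.86, (1.62) p.87; Balaban1985Variational, (148)–(152) p.301; Balaban1985BackgroundPropagators, Thm 3.3 p.399; Balaban1984PropagatorsII, Prop. 2.6 (2.136) p.247; Balaban1987RG1, (0.3) p.252] -/
theorem ineq159FlatDentedCubeMemberPrintedZ_holds (d ℓ : ℕ) (hℓ : 4 ≤ ℓ) (hodd : Odd (ℓ + 1)) : Ineq159FlatDentedCubeMemberPrintedZ (d + 1) (ℓ + 1) :=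
  ineq159FlatDentedCubeMemberPrintedZ_of_printed d ℓ hodd (ineq159FlatDentedCubeMemberPrinted_holds d ℓ hℓ hodd)

end Literature.MathematicalPhysics.QuantumFieldTheory.Balaban1983to89.B8Ineq159FlatDentedCubeMemberPrintedRec

end

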